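import Mathlib.Analysis.Complex.CauchyIntegral
import Mathlib.MeasureTheory.Integral.CircleIntegral
import Mathlib.Analysis.SpecialFunctions.Integrals.Basic
import Mathlib.MeasureTheory.Integral.IntervalIntegral.IntegrationByParts
import Literature.Barriers.AtomisticToContinuum.EnergyAsymptoticsWithoutCondensation

/-!
# Closed-form Poisson integrals of the semicircle (towards `EnergyAsymptoticsWithoutCondensation_holds`)

First of three sibling files proving the named fact
`Literature.Barriers.AtomisticToContinuum.EnergyAsymptoticsWithoutCondensation`
(= `BoseGas.LiebLiniger.LiebLiniger_bogoliubovTwoOrders`, LSSY (B.19): for the Lieb–Liniger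
equation, `e(γ) = γ - (4/3π)γ^{3/2} + o(γ^{3/2})`).

The Lieb–Liniger/Love operator is `(K_κ u)(k) = (1/π)∫_{-1}^{1} u(p) κ dp/(κ² + (p-k)²)`, the
Poisson integral of `u𝟙_{[-1,1]}` at the point `z = k + iκ` of the upper half-plane.  This file
computes it in closed form on the functions `√(1-p²)` and `(1-p²)√(1-p²)` (and, by scaling, on
`√(a²-p²)` over `[-a, a]`), which are the sub/super-solutions and dual test functions of the proof:

* `integral_inv_cos_sub`: `∫₀^π dθ/(cos θ - z) = -π/w`, where `w = root k κ` is the square root of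
  `z² - 1` with positive imaginary part, written in real closed form
  `w = kκ/B + iB`, `B = imRoot k κ = √((D + √(D² + 4k²κ²))/2)`, `D = 1 - k² + κ²`
  (`root_sq : w² = z² - 1`).  Proof: `ζ = e^{iθ}` turns `2∫₀^π = ∫₀^{2π}` into the circle integral
  `∮_{|ζ|=1} dζ /(i (ζ - z - w)(ζ - z + w))`; the roots `z ± w` have product `1` and
  `|z - w| < 1 < |z + w|`, so Mathlib's `∮ (ζ-a)⁻¹ = 2πi` (inside) and Cauchy–Goursat (outside) give
  the value.  No branch of a complex square root or logarithm is used.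
* `integral_sin_sq_mul_inv_cos_sub`, `integral_sin_four_mul_inv_cos_sub`:
  `∫₀^π sin²θ dθ/(cos θ - z) = π(w - z)`, `∫₀^π sin⁴θ dθ/(cos θ - z) = π[(1-z²)(w-z) - z/2]`
  (polynomial division by `cos θ - z`).
* Real forms (`p = cos θ`, imaginary parts): `integral_sqrt_mul_poissonKernel`
  `∫_{-1}^{1} √(1-p²) P dp = π(B - κ)`, its scaled version on `[-a,a]`, and
  `integral_sqrt_three_mul_poissonKernel`
  `∫_{-1}^{1} (1-p²)√(1-p²) P dp = π[DB - Dκ - 2k²κ²/B + 2k²κ - κ/2]`,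
  with `P = poissonKernel κ k p = κ/(κ² + (p-k)²)`.
* Elementary inequalities for `B`: `D ≤ B²`, `B² ≤ D + k²κ²/D`, `B² ≤ D + |k|κ`.

These are classical potential-theoretic formulas (the Stieltjes transform of the semicircle law,
`(1/π)∫_{-1}^{1} √(1-p²) dp/(z-p) = z - √(z²-1)`); we know of no convenient printed source for
exactly these normalisations and tag them `[folklore]`.

## References

* [LSSY2005] E. H. Lieb, R. Seiringer, J. P. Solovej, J. Yngvason, *The Mathematics of the Bose
  Gas and its Condensation*, Birkhäuser 2005, App. B (B.14)–(B.19) (the equation and the claim).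
* [TracyWidom2016] C. A. Tracy, H. Widom, *On the ground state energy of the δ-function Bose
  gas*, J. Phys. A 49 (2016) 294001, §1.1–1.2 (Love-equation form, `‖K‖ = (2/π)arctan(1/κ)`).
-/

noncomputable section

open MeasureTheory Set Filter Real intervalIntegral Metric
open scoped Topology

namespace Literature.Barriers.AtomisticToContinuum.BoseGas.LiebLiniger

/-! ### The root `w` of `w² = z² - 1` in real closed form -/

/-- `D(k, κ) = 1 - k² + κ² = -Re(z² - 1)` for `z = k + iκ`. [folklore] -/
def dRoot (k κ : ℝ) : ℝ := 1 - k ^ 2 + κ ^ 2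

/-- `B(k, κ) = Im √(z² - 1)` for `z = k + iκ` (the root with positive imaginary part), in closed
real form `B = √((D + √(D² + 4k²κ²))/2)`. [folklore] -/
def imRoot (k κ : ℝ) : ℝ := √((dRoot k κ + √(dRoot k κ ^ 2 + 4 * k ^ 2 * κ ^ 2)) / 2)

/-- The root `w = kκ/B + iB` of `w² = z² - 1` with `Im w = B > 0` (`z = k + iκ`, `κ > 0`).
[folklore] -/
def root (k κ : ℝ) : ℂ := ⟨k * κ / imRoot k κ, imRoot k κ⟩

/-- `D + √(D² + 4k²κ²) > 0` for `κ > 0`. [folklore] -/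
lemma dRoot_add_sqrt_pos (k : ℝ) {κ : ℝ} (hκ : 0 < κ) :
    0 < dRoot k κ + √(dRoot k κ ^ 2 + 4 * k ^ 2 * κ ^ 2) := by
  rcases lt_or_ge 0 (dRoot k κ) with hD | hD
  · positivity
  · have hk : k ≠ 0 := by
      rintro rfl
      simp [dRoot] at hD
      nlinarith
    have h1 : √(dRoot k κ ^ 2) < √(dRoot k κ ^ 2 + 4 * k ^ 2 * κ ^ 2) := by
      apply Real.sqrt_lt_sqrt (sq_nonneg _)
      have : 0 < k ^ 2 * κ ^ 2 := by positivity
      linarith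
    rw [Real.sqrt_sq_eq_abs, abs_of_nonpos hD] at h1
    linarith

/-- `B > 0`. [folklore] -/
lemma imRoot_pos (k : ℝ) {κ : ℝ} (hκ : 0 < κ) : 0 < imRoot k κ := by
  unfold imRoot
  apply Real.sqrt_pos.2
  have := dRoot_add_sqrt_pos k hκ
  positivity

/-- `B² = (D + √(D² + 4k²κ²))/2`. [folklore] -/
lemma imRoot_sq (k : ℝ) {κ : ℝ} (hκ : 0 < κ) :
    imRoot k κ ^ 2 = (dRoot k κ + √(dRoot k κ ^ 2 + 4 * k ^ 2 * κ ^ 2)) / 2 := by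
  unfold imRoot
  rw [Real.sq_sqrt]
  have := dRoot_add_sqrt_pos k hκ
  positivity

/-- The quartic `B⁴ - D B² - k²κ² = 0`. [folklore] -/
lemma imRoot_quartic (k : ℝ) {κ : ℝ} (hκ : 0 < κ) :
    (imRoot k κ ^ 2) ^ 2 - dRoot k κ * imRoot k κ ^ 2 - k ^ 2 * κ ^ 2 = 0 := by
  rw [imRoot_sq k hκ]
  have hS : √(dRoot k κ ^ 2 + 4 * k ^ 2 * κ ^ 2) ^ 2 = dRoot k κ ^ 2 + 4 * k ^ 2 * κ ^ 2 :=
    Real.sq_sqrt (by positivity)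
  nlinarith [hS]

/-- `D ≤ B²`. [folklore] -/
lemma dRoot_le_imRoot_sq (k : ℝ) {κ : ℝ} (hκ : 0 < κ) : dRoot k κ ≤ imRoot k κ ^ 2 := by
  rw [imRoot_sq k hκ]
  have h1 : |dRoot k κ| ≤ √(dRoot k κ ^ 2 + 4 * k ^ 2 * κ ^ 2) := by
    rw [← Real.sqrt_sq_eq_abs]
    exact Real.sqrt_le_sqrt (by nlinarith)
  have h2 := le_abs_self (dRoot k κ)
  linarith

/-- `B² ≤ D + k²κ²/D` when `D > 0` (bulk upper bound). [folklore] -/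
lemma imRoot_sq_le_bulk (k : ℝ) {κ : ℝ} (hκ : 0 < κ) (hD : 0 < dRoot k κ) :
    imRoot k κ ^ 2 ≤ dRoot k κ + k ^ 2 * κ ^ 2 / dRoot k κ := by
  rw [imRoot_sq k hκ]
  have h1 : √(dRoot k κ ^ 2 + 4 * k ^ 2 * κ ^ 2) ≤ dRoot k κ + 2 * k ^ 2 * κ ^ 2 / dRoot k κ := by
    rw [Real.sqrt_le_left (by positivity)]
    have : (dRoot k κ + 2 * k ^ 2 * κ ^ 2 / dRoot k κ) ^ 2
        = dRoot k κ ^ 2 + 4 * k ^ 2 * κ ^ 2 + (2 * k ^ 2 * κ ^ 2 / dRoot k κ) ^ 2 := by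
      field_simp
      ring
    rw [this]
    nlinarith
  have : dRoot k κ + k ^ 2 * κ ^ 2 / dRoot k κ
      = (dRoot k κ + (dRoot k κ + 2 * k ^ 2 * κ ^ 2 / dRoot k κ)) / 2 := by
    field_simp
    ring
  rw [this]
  linarith

/-- `B² ≤ D + |k|κ` when `D ≥ 0` (edge upper bound). [folklore] -/
lemma imRoot_sq_le_edge (k : ℝ) {κ : ℝ} (hκ : 0 < κ) (hD : 0 ≤ dRoot k κ) :
    imRoot k κ ^ 2 ≤ dRoot k κ + |k| * κ := by
  rw [imRoot_sq k hκ]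
  have h1 : √(dRoot k κ ^ 2 + 4 * k ^ 2 * κ ^ 2) ≤ dRoot k κ + 2 * |k| * κ := by
    rw [Real.sqrt_le_left (by positivity)]
    have hk : |k| ^ 2 = k ^ 2 := sq_abs k
    have h0 : 0 ≤ dRoot k κ * |k| * κ := by positivity
    nlinarith [abs_nonneg k]
  linarith

/-- `B² ≥ |k| κ` when `D ≥ 0` (edge lower bound). [folklore] -/
lemma abs_mul_le_imRoot_sq (k : ℝ) {κ : ℝ} (hκ : 0 < κ) (hD : 0 ≤ dRoot k κ) :
    |k| * κ ≤ imRoot k κ ^ 2 := by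
  rw [imRoot_sq k hκ]
  have h1 : 2 * |k| * κ ≤ √(dRoot k κ ^ 2 + 4 * k ^ 2 * κ ^ 2) := by
    apply Real.le_sqrt_of_sq_le
    have hk : |k| ^ 2 = k ^ 2 := sq_abs k
    nlinarith
  linarith

/-- `w² = z² - 1`. [folklore] -/
lemma root_sq (k : ℝ) {κ : ℝ} (hκ : 0 < κ) :
    root k κ ^ 2 = (⟨k, κ⟩ : ℂ) ^ 2 - 1 := by
  have hB := imRoot_pos k hκ
  have hq := imRoot_quartic k hκ
  apply Complex.ext
  · simp only [root, sq, Complex.mul_re, Complex.sub_re, Complex.one_re]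
    field_simp
    unfold dRoot at hq
    nlinarith [hq]
  · simp only [root, sq, Complex.mul_im, Complex.sub_im, Complex.one_im]
    field_simp
    ring

/-- `Im w = B`. [folklore] -/
lemma root_im (k κ : ℝ) : (root k κ).im = imRoot k κ := rfl

/-- `Re w = kκ/B`. [folklore] -/
lemma root_re (k κ : ℝ) : (root k κ).re = k * κ / imRoot k κ := rfl

/-- `w ≠ 0`. [folklore] -/
lemma root_ne_zero (k : ℝ) {κ : ℝ} (hκ : 0 < κ) : root k κ ≠ 0 := by
  intro h
  have := congrArg Complex.im h
  simp [root_im] at this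
  exact (imRoot_pos k hκ).ne' this

/-- The two roots `z ± w` of `ζ² - 2zζ + 1` have product one. [folklore] -/
lemma zpt_add_root_mul (k : ℝ) {κ : ℝ} (hκ : 0 < κ) :
    ((⟨k, κ⟩ : ℂ) + root k κ) * (⟨k, κ⟩ - root k κ) = 1 := by
  have h := root_sq k hκ
  linear_combination (-1 : ℂ) * h

/-- `|z - w| < 1 < |z + w|`: exactly one root lies in the unit disc. [folklore] -/
lemma norm_zpt_sub_root_lt (k : ℝ) {κ : ℝ} (hκ : 0 < κ) :
    ‖(⟨k, κ⟩ : ℂ) - root k κ‖ < 1 ∧ 1 < ‖(⟨k, κ⟩ : ℂ) + root k κ‖ := by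
  set z : ℂ := ⟨k, κ⟩
  set w := root k κ
  have hB := imRoot_pos k hκ
  have hprod : ‖z + w‖ * ‖z - w‖ = 1 := by
    rw [← norm_mul, zpt_add_root_mul k hκ, norm_one]
  have hlt : ‖z - w‖ ^ 2 < ‖z + w‖ ^ 2 := by
    rw [← Complex.normSq_eq_norm_sq, ← Complex.normSq_eq_norm_sq]
    simp only [Complex.normSq_apply, Complex.add_re, Complex.add_im, Complex.sub_re,
      Complex.sub_im, z, w, root_re, root_im]
    have h1 : 0 < κ * imRoot k κ := mul_pos hκ hB
    have h2 : 0 ≤ k * (k * κ / imRoot k κ) := by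
      have : k * (k * κ / imRoot k κ) = k ^ 2 * κ / imRoot k κ := by ring
      rw [this]; positivity
    nlinarith
  have hlt' : ‖z - w‖ < ‖z + w‖ := lt_of_pow_lt_pow_left₀ 2 (norm_nonneg _) hlt
  have h0 : 0 ≤ ‖z - w‖ := norm_nonneg _
  constructor
  · by_contra h
    have h' : 1 ≤ ‖z - w‖ := le_of_not_gt h
    have : 1 < ‖z + w‖ := lt_of_le_of_lt h' hlt'
    nlinarith
  · by_contra h
    have h' : ‖z + w‖ ≤ 1 := le_of_not_gt h
    have : ‖z - w‖ < 1 := lt_of_lt_of_le hlt' h'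
    nlinarith

/-! ### The arc integral `∫₀^π dθ/(cos θ - z)` by residues -/

/-- `cos θ - z ≠ 0` for real `θ` and `Im z = κ > 0`. [folklore] -/
lemma cos_sub_zpt_ne_zero (k : ℝ) {κ : ℝ} (hκ : 0 < κ) (θ : ℝ) :
    (Real.cos θ : ℂ) - ⟨k, κ⟩ ≠ 0 := by
  intro h
  have := congrArg Complex.im h
  simp at this
  exact hκ.ne' this

/-- Integrability of `g(θ)/(cos θ - z)` for continuous real `g`. [folklore] -/
lemma intervalIntegrable_mul_inv_cos_sub (k : ℝ) {κ : ℝ} (hκ : 0 < κ) (g : ℝ → ℝ)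
    (hg : Continuous g) (a b : ℝ) :
    IntervalIntegrable (fun θ : ℝ => (g θ : ℂ) * ((Real.cos θ : ℂ) - ⟨k, κ⟩)⁻¹) volume a b := by
  apply Continuous.intervalIntegrable
  apply Continuous.mul (by fun_prop)
  exact Continuous.inv₀ (by fun_prop) (cos_sub_zpt_ne_zero k hκ)

/-- **The arc integral** `∫₀^π dθ/(cos θ - z) = -π/w` for `z = k + iκ`, `κ > 0`,
`w = root k κ`.  Proof by residues on the unit circle (see the module docstring). [folklore] -/
theorem integral_inv_cos_sub (k : ℝ) {κ : ℝ} (hκ : 0 < κ) :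
    ∫ θ in (0 : ℝ)..π, ((Real.cos θ : ℂ) - ⟨k, κ⟩)⁻¹ = -π / root k κ := by
  set z : ℂ := ⟨k, κ⟩ with hz
  set w := root k κ with hw
  have hB := imRoot_pos k hκ
  have hw0 : w ≠ 0 := root_ne_zero k hκ
  obtain ⟨hr₂, hr₁⟩ := norm_zpt_sub_root_lt k hκ
  have hprod : (z + w) * (z - w) = 1 := zpt_add_root_mul k hκ
  have hcos : ∀ θ : ℝ, (Real.cos θ : ℂ) - z ≠ 0 := cos_sub_zpt_ne_zero k hκ
  -- Step 1: the circle integral by residues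
  have hI1 : (∮ ζ in C(0, 1), (ζ - (z + w))⁻¹) = 0 := by
    apply Complex.circleIntegral_eq_zero_of_differentiable_on_off_countable zero_le_one
      countable_empty
    · apply ContinuousOn.inv₀ (by fun_prop)
      intro ζ hζ h
      rw [sub_eq_zero] at h
      simp only [mem_closedBall, dist_zero_right] at hζ
      rw [h] at hζ
      linarith
    · intro ζ hζ
      apply DifferentiableAt.inv (by fun_prop)
      intro h
      rw [sub_eq_zero] at h
      have := hζ.1
      simp only [mem_ball, dist_zero_right] at this
      rw [h] at this
      linarith
  have hI2 : (∮ ζ in C(0, 1), (ζ - (z - w))⁻¹) = 2 * π * Complex.I := by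
    apply circleIntegral.integral_sub_inv_of_mem_ball
    simpa using hr₂
  have hne : ∀ ζ ∈ sphere (0 : ℂ) 1, ζ - (z + w) ≠ 0 ∧ ζ - (z - w) ≠ 0 := by
    intro ζ hζ
    simp only [mem_sphere, dist_zero_right] at hζ
    constructor
    · intro h; rw [sub_eq_zero] at h; rw [h] at hζ; linarith
    · intro h; rw [sub_eq_zero] at h; rw [h] at hζ; linarith
  have hcirc : (∮ ζ in C(0, 1), ((ζ - (z + w)) * (ζ - (z - w)))⁻¹) = -π * Complex.I / w := by
    have heq : EqOn (fun ζ : ℂ => ((ζ - (z + w)) * (ζ - (z - w)))⁻¹)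
        (fun ζ => (2 * w)⁻¹ * ((ζ - (z + w))⁻¹ - (ζ - (z - w))⁻¹)) (sphere (0 : ℂ) 1) := by
      intro ζ hζ
      obtain ⟨h1, h2⟩ := hne ζ hζ
      have h2w : (2 : ℂ) * w ≠ 0 := mul_ne_zero two_ne_zero hw0
      simp only
      field_simp
      ring
    rw [circleIntegral.integral_congr zero_le_one heq, circleIntegral.integral_const_mul,
      circleIntegral.integral_sub, hI1, hI2]
    · field_simp
      ring
    · apply ContinuousOn.circleIntegrable zero_le_one
      apply ContinuousOn.inv₀ (by fun_prop)
      exact fun ζ hζ => (hne ζ hζ).1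
    · apply ContinuousOn.circleIntegrable zero_le_one
      apply ContinuousOn.inv₀ (by fun_prop)
      exact fun ζ hζ => (hne ζ hζ).2
  -- Step 2: the parametrised form of the same circle integral
  have hpar : (∮ ζ in C(0, 1), ((ζ - (z + w)) * (ζ - (z - w)))⁻¹)
      = ∫ θ in (0 : ℝ)..2 * π, Complex.I / 2 * ((Real.cos θ : ℂ) - z)⁻¹ := by
    simp only [circleIntegral, deriv_circleMap, circleMap_zero, Complex.ofReal_one, one_mul,
      smul_eq_mul]
    apply intervalIntegral.integral_congr
    intro θ _
    have hu : Complex.exp (θ * Complex.I) ≠ 0 := Complex.exp_ne_zero _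
    have h2cos : (2 : ℂ) * (Real.cos θ : ℂ) =
        Complex.exp (θ * Complex.I) + (Complex.exp (θ * Complex.I))⁻¹ := by
      rw [Complex.ofReal_cos, Complex.two_cos, ← Complex.exp_neg, neg_mul]
    have hcosu : (Real.cos θ : ℂ) =
        (Complex.exp (θ * Complex.I) + (Complex.exp (θ * Complex.I))⁻¹) / 2 := by
      rw [← h2cos]; ring
    have hfac : (Complex.exp (θ * Complex.I) - (z + w)) * (Complex.exp (θ * Complex.I) - (z - w))
        = Complex.exp (θ * Complex.I) * (2 * ((Real.cos θ : ℂ) - z)) := by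
      calc (Complex.exp (θ * Complex.I) - (z + w)) * (Complex.exp (θ * Complex.I) - (z - w))
          = Complex.exp (θ * Complex.I) ^ 2 - 2 * z * Complex.exp (θ * Complex.I)
            + (z + w) * (z - w) := by ring
        _ = Complex.exp (θ * Complex.I) ^ 2 - 2 * z * Complex.exp (θ * Complex.I) + 1 := by
            rw [hprod]
        _ = Complex.exp (θ * Complex.I) * (2 * ((Real.cos θ : ℂ) - z)) := by
            rw [hcosu]; field_simp; ring
    simp only
    rw [hfac]
    have hc := hcos θ
    field_simp
  -- Step 3: fold `[0, 2π]` onto `[0, π]`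
  have hint : ∀ a b : ℝ, IntervalIntegrable (fun θ : ℝ => ((Real.cos θ : ℂ) - z)⁻¹) volume a b := by
    intro a b
    apply Continuous.intervalIntegrable
    exact Continuous.inv₀ (by fun_prop) hcos
  have hfold : ∫ θ in (0 : ℝ)..2 * π, ((Real.cos θ : ℂ) - z)⁻¹
      = 2 * ∫ θ in (0 : ℝ)..π, ((Real.cos θ : ℂ) - z)⁻¹ := by
    rw [← integral_add_adjacent_intervals (hint 0 π) (hint π (2 * π))]
    have : ∫ θ in π..2 * π, ((Real.cos θ : ℂ) - z)⁻¹
        = ∫ θ in π..2 * π, ((Real.cos (2 * π - θ) : ℂ) - z)⁻¹ := by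
      simp only [Real.cos_two_pi_sub]
    rw [this, intervalIntegral.integral_comp_sub_left (fun θ => ((Real.cos θ : ℂ) - z)⁻¹) (2 * π)]
    have h1 : 2 * π - 2 * π = 0 := by ring
    have h2 : 2 * π - π = π := by ring
    rw [h1, h2]
    ring
  have key : Complex.I / 2 * (2 * ∫ θ in (0 : ℝ)..π, ((Real.cos θ : ℂ) - z)⁻¹)
      = -π * Complex.I / w := by
    rw [← hfold, ← intervalIntegral.integral_const_mul, ← hpar, hcirc]
  have hI : Complex.I ≠ 0 := Complex.I_ne_zero
  field_simp at key
  field_simp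
  linear_combination key

/-- `∫₀^π sin²θ dθ/(cos θ - z) = π (w - z)`. [folklore] -/
theorem integral_sin_sq_mul_inv_cos_sub (k : ℝ) {κ : ℝ} (hκ : 0 < κ) :
    ∫ θ in (0 : ℝ)..π, ((Real.sin θ ^ 2 : ℝ) : ℂ) * ((Real.cos θ : ℂ) - ⟨k, κ⟩)⁻¹
      = π * (root k κ - ⟨k, κ⟩) := by
  set z : ℂ := ⟨k, κ⟩ with hz
  set w := root k κ with hw
  have hw0 : w ≠ 0 := root_ne_zero k hκ
  have hcos := cos_sub_zpt_ne_zero k hκ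
  have hpt : ∀ θ : ℝ, ((Real.sin θ ^ 2 : ℝ) : ℂ) * ((Real.cos θ : ℂ) - z)⁻¹
      = (1 - z ^ 2) * ((Real.cos θ : ℂ) - z)⁻¹ - ((Real.cos θ : ℂ) + z) := by
    intro θ
    have hc : (Real.cos θ : ℂ) - z ≠ 0 := hcos θ
    have hs : ((Real.sin θ ^ 2 : ℝ) : ℂ) = 1 - (Real.cos θ : ℂ) ^ 2 := by
      rw [Real.sin_sq]; push_cast; ring
    rw [hs]
    field_simp
    ring
  have hint := intervalIntegrable_mul_inv_cos_sub k hκ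
  have hJ : IntervalIntegrable (fun θ : ℝ => ((Real.cos θ : ℂ) - z)⁻¹) volume 0 π := by
    simpa using hint (fun _ => (1 : ℝ)) continuous_const 0 π
  simp_rw [hpt]
  rw [intervalIntegral.integral_sub, intervalIntegral.integral_const_mul,
    integral_inv_cos_sub k hκ, intervalIntegral.integral_add, intervalIntegral.integral_const,
    intervalIntegral.integral_ofReal, integral_cos]
  · simp only [Real.sin_pi, Real.sin_zero, sub_zero, Complex.ofReal_zero, zero_add,
      Complex.real_smul]
    have h1 : (1 : ℂ) - z ^ 2 = -w ^ 2 := by rw [hw, root_sq k hκ]; ring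
    rw [h1, ← hw]
    field_simp
  · exact Continuous.intervalIntegrable (by fun_prop) _ _
  · exact intervalIntegrable_const
  · exact (hJ.const_mul _)
  · exact Continuous.intervalIntegrable (by fun_prop) _ _

/-- `∫₀^π sin⁴θ dθ/(cos θ - z) = π[(1 - z²)(w - z) - z/2]`. [folklore] -/
theorem integral_sin_four_mul_inv_cos_sub (k : ℝ) {κ : ℝ} (hκ : 0 < κ) :
    ∫ θ in (0 : ℝ)..π, ((Real.sin θ ^ 4 : ℝ) : ℂ) * ((Real.cos θ : ℂ) - ⟨k, κ⟩)⁻¹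
      = π * ((1 - (⟨k, κ⟩ : ℂ) ^ 2) * (root k κ - ⟨k, κ⟩) - (⟨k, κ⟩ : ℂ) / 2) := by
  set z : ℂ := ⟨k, κ⟩ with hz
  have hcos := cos_sub_zpt_ne_zero k hκ
  have hpt : ∀ θ : ℝ, ((Real.sin θ ^ 4 : ℝ) : ℂ) * ((Real.cos θ : ℂ) - z)⁻¹
      = (1 - z ^ 2) * (((Real.sin θ ^ 2 : ℝ) : ℂ) * ((Real.cos θ : ℂ) - z)⁻¹)
        - (((Real.sin θ ^ 2 * Real.cos θ : ℝ) : ℂ) + z * ((Real.sin θ ^ 2 : ℝ) : ℂ)) := by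
    intro θ
    have hc : (Real.cos θ : ℂ) - z ≠ 0 := hcos θ
    have hs : ((Real.sin θ ^ 2 : ℝ) : ℂ) = 1 - (Real.cos θ : ℂ) ^ 2 := by
      rw [Real.sin_sq]; push_cast; ring
    rw [show Real.sin θ ^ 4 = Real.sin θ ^ 2 * Real.sin θ ^ 2 by ring, Complex.ofReal_mul,
      Complex.ofReal_mul, hs]
    field_simp
    ring
  have hint := intervalIntegrable_mul_inv_cos_sub k hκ
  simp_rw [hpt]
  rw [intervalIntegral.integral_sub, intervalIntegral.integral_const_mul,
    integral_sin_sq_mul_inv_cos_sub k hκ, intervalIntegral.integral_add,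
    intervalIntegral.integral_const_mul, intervalIntegral.integral_ofReal,
    intervalIntegral.integral_ofReal, integral_sin_sq]
  · have h0 : ∫ x in (0 : ℝ)..π, Real.sin x ^ 2 * Real.cos x = 0 := by
      have := integral_sin_pow_mul_cos_pow_odd (a := 0) (b := π) 2 0
      simp only [mul_zero, zero_add, pow_one, Real.sin_zero, Real.sin_pi,
        intervalIntegral.integral_same] at this
      exact this
    rw [h0]
    simp only [Real.sin_pi, Real.sin_zero, Real.cos_zero, zero_mul, sub_zero,
      Complex.ofReal_zero, zero_add]
    push_cast
    ring
  · exact Continuous.intervalIntegrable (by fun_prop) _ _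
  · exact Continuous.intervalIntegrable (by fun_prop) _ _
  · exact ((hint _ (by fun_prop) 0 π).const_mul _)
  · exact Continuous.intervalIntegrable (by fun_prop) _ _

/-! ### Real form: Poisson integrals over `[-1, 1]` -/

/-- The Poisson kernel of the upper half-plane at height `κ`, centred at `k`:
`P_κ(k, p) = κ / (κ² + (p - k)²)` (total mass `π` on `ℝ`); `(1/π) P_c(k, p)` is the kernel of the
Lieb–Liniger equation (B.14). [cite: LSSY2005, App. B (B.14)] -/
def poissonKernel (κ k p : ℝ) : ℝ := κ / (κ ^ 2 + (p - k) ^ 2)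

/-- Unfolding lemma for `poissonKernel`. [folklore] -/
lemma poissonKernel_def (κ k p : ℝ) : poissonKernel κ k p = κ / (κ ^ 2 + (p - k) ^ 2) := rfl

/-- The kernel is symmetric in `(k, p)`. [folklore] -/
lemma poissonKernel_comm (κ k p : ℝ) : poissonKernel κ k p = poissonKernel κ p k := by
  unfold poissonKernel; ring

/-- Continuity of `p ↦ P_κ(k, p)`. [folklore] -/
lemma continuous_poissonKernel {κ : ℝ} (hκ : 0 < κ) (k : ℝ) :
    Continuous (fun p => poissonKernel κ k p) := by
  unfold poissonKernel
  apply Continuous.div continuous_const (by fun_prop)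
  intro p; positivity

/-- Continuity of `k ↦ P_κ(k, p)`. [folklore] -/
lemma continuous_poissonKernel_left {κ : ℝ} (hκ : 0 < κ) (p : ℝ) :
    Continuous (fun k => poissonKernel κ k p) := by
  unfold poissonKernel
  apply Continuous.div continuous_const (by fun_prop)
  intro k; positivity

/-- Joint continuity of `(k, p) ↦ P_κ(k, p)`. [folklore] -/
lemma continuous_poissonKernel_uncurry {κ : ℝ} (hκ : 0 < κ) :
    Continuous (fun q : ℝ × ℝ => poissonKernel κ q.1 q.2) := by
  unfold poissonKernel
  apply Continuous.div continuous_const (by fun_prop)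
  intro q; positivity

/-- `P_κ > 0`. [folklore] -/
lemma poissonKernel_pos {κ : ℝ} (hκ : 0 < κ) (k p : ℝ) : 0 < poissonKernel κ k p := by
  unfold poissonKernel; positivity

/-- `Im (s/(c - z)) = s · P_κ(k, c)` for real `s, c` and `z = k + iκ`. [folklore] -/
lemma im_ofReal_mul_inv_sub_zpt (s c k κ : ℝ) :
    ((s : ℂ) * ((c : ℂ) - ⟨k, κ⟩)⁻¹).im = s * poissonKernel κ k c := by
  rw [Complex.im_ofReal_mul, Complex.inv_im, Complex.normSq_apply]
  simp only [Complex.sub_re, Complex.ofReal_re, Complex.sub_im, Complex.ofReal_im, zero_sub,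
    poissonKernel]
  have : (c - k) * (c - k) + -κ * -κ = κ ^ 2 + (c - k) ^ 2 := by ring
  rw [this, neg_neg]

/-- Change of variables `p = cos θ`: `∫_{-1}^{1} g(p) dp = ∫₀^π g(cos θ) sin θ dθ`. [folklore] -/
lemma integral_comp_cos_mul_sin {g : ℝ → ℝ} (hg : Continuous g) :
    ∫ p in (-1 : ℝ)..1, g p = ∫ θ in (0 : ℝ)..π, g (Real.cos θ) * Real.sin θ := by
  have h := intervalIntegral.integral_comp_mul_deriv (a := 0) (b := π) (f := Real.cos)
    (f' := fun θ => -Real.sin θ) (g := g) (fun θ _ => Real.hasDerivAt_cos θ) (by fun_prop) hg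
  simp only [Function.comp, Real.cos_zero, Real.cos_pi, mul_neg, intervalIntegral.integral_neg,
    intervalIntegral.integral_symm (-1 : ℝ) 1] at h
  linarith

/-- **Poisson integral of the semicircle**:
`∫_{-1}^{1} √(1-p²) P_κ(k,p) dp = π (B(k,κ) - κ)`, i.e. `(1/π)K[√(1-·²)](k) = Im(w - z)`.
[folklore] -/
theorem integral_sqrt_mul_poissonKernel (k : ℝ) {κ : ℝ} (hκ : 0 < κ) :
    ∫ p in (-1 : ℝ)..1, √(1 - p ^ 2) * poissonKernel κ k p = π * (imRoot k κ - κ) := by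
  have hcont : Continuous (fun p => √(1 - p ^ 2) * poissonKernel κ k p) :=
    Continuous.mul (by fun_prop) (continuous_poissonKernel hκ k)
  rw [integral_comp_cos_mul_sin hcont]
  have hpt : EqOn (fun θ => √(1 - Real.cos θ ^ 2) * poissonKernel κ k (Real.cos θ) * Real.sin θ)
      (fun θ => (((Real.sin θ ^ 2 : ℝ) : ℂ) * ((Real.cos θ : ℂ) - ⟨k, κ⟩)⁻¹).im)
      (uIcc 0 π) := by
    intro θ hθ
    rw [uIcc_of_le Real.pi_pos.le] at hθ
    have hs : 0 ≤ Real.sin θ := Real.sin_nonneg_of_nonneg_of_le_pi hθ.1 hθ.2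
    simp only
    rw [im_ofReal_mul_inv_sub_zpt, ← Real.sin_sq, Real.sqrt_sq hs]
    ring
  rw [intervalIntegral.integral_congr hpt]
  have := Complex.imCLM.intervalIntegral_comp_comm
    (intervalIntegrable_mul_inv_cos_sub k hκ (fun θ => Real.sin θ ^ 2) (by fun_prop) 0 π)
  simp only [Complex.imCLM_apply] at this
  rw [this, integral_sin_sq_mul_inv_cos_sub k hκ]
  simp [root_im]

/-- Scaled semicircle on `[-a, a]`:
`∫_{-a}^{a} √(a²-p²) P_κ(k,p) dp = π (a B(k/a, κ/a) - κ)`. [folklore] -/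
theorem integral_sqrt_mul_poissonKernel_scaled (k : ℝ) {κ a : ℝ} (hκ : 0 < κ) (ha : 0 < a) :
    ∫ p in (-a : ℝ)..a, √(a ^ 2 - p ^ 2) * poissonKernel κ k p
      = π * (a * imRoot (k / a) (κ / a) - κ) := by
  have hsub := intervalIntegral.smul_integral_comp_mul_left
    (fun p => √(a ^ 2 - p ^ 2) * poissonKernel κ k p) a (a := -1) (b := 1)
  simp only [mul_neg, mul_one, smul_eq_mul] at hsub
  rw [← hsub]
  have hpt : ∀ q : ℝ, √(a ^ 2 - (a * q) ^ 2) * poissonKernel κ k (a * q)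
      = a * (a⁻¹ * (√(1 - q ^ 2) * poissonKernel (κ / a) (k / a) q)) := by
    intro q
    have h1 : √(a ^ 2 - (a * q) ^ 2) = a * √(1 - q ^ 2) := by
      rw [show a ^ 2 - (a * q) ^ 2 = a ^ 2 * (1 - q ^ 2) by ring, Real.sqrt_mul (sq_nonneg a),
        Real.sqrt_sq ha.le]
    rw [h1]
    simp only [poissonKernel]
    have h2 : (κ / a) ^ 2 + (q - k / a) ^ 2 ≠ 0 := by positivity
    have h3 : κ ^ 2 + (a * q - k) ^ 2 ≠ 0 := by positivity
    field_simp
  simp_rw [hpt]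
  rw [intervalIntegral.integral_const_mul, intervalIntegral.integral_const_mul,
    integral_sqrt_mul_poissonKernel (k / a) (div_pos hκ ha)]
  field_simp

/-- **Poisson integral of `(1-p²)^{3/2}`**:
`∫_{-1}^{1} (1-p²)√(1-p²) P_κ(k,p) dp = π [D B - D κ - 2k²κ²/B + 2k²κ - κ/2]`,
`D = 1 - k² + κ²`, `B = B(k, κ)`. [folklore] -/
theorem integral_sqrt_three_mul_poissonKernel (k : ℝ) {κ : ℝ} (hκ : 0 < κ) :
    ∫ p in (-1 : ℝ)..1, (1 - p ^ 2) * √(1 - p ^ 2) * poissonKernel κ k p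
      = π * (dRoot k κ * imRoot k κ - dRoot k κ * κ - 2 * k ^ 2 * κ ^ 2 / imRoot k κ
          + 2 * k ^ 2 * κ - κ / 2) := by
  have hB := imRoot_pos k hκ
  have hcont : Continuous (fun p => (1 - p ^ 2) * √(1 - p ^ 2) * poissonKernel κ k p) :=
    Continuous.mul (by fun_prop) (continuous_poissonKernel hκ k)
  rw [integral_comp_cos_mul_sin hcont]
  have hpt : EqOn (fun θ => (1 - Real.cos θ ^ 2) * √(1 - Real.cos θ ^ 2)
        * poissonKernel κ k (Real.cos θ) * Real.sin θ)
      (fun θ => (((Real.sin θ ^ 4 : ℝ) : ℂ) * ((Real.cos θ : ℂ) - ⟨k, κ⟩)⁻¹).im)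
      (uIcc 0 π) := by
    intro θ hθ
    rw [uIcc_of_le Real.pi_pos.le] at hθ
    have hs : 0 ≤ Real.sin θ := Real.sin_nonneg_of_nonneg_of_le_pi hθ.1 hθ.2
    simp only
    rw [im_ofReal_mul_inv_sub_zpt, ← Real.sin_sq, Real.sqrt_sq hs]
    ring
  rw [intervalIntegral.integral_congr hpt]
  have := Complex.imCLM.intervalIntegral_comp_comm
    (intervalIntegrable_mul_inv_cos_sub k hκ (fun θ => Real.sin θ ^ 4) (by fun_prop) 0 π)
  simp only [Complex.imCLM_apply] at this
  rw [this, integral_sin_four_mul_inv_cos_sub k hκ]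
  simp only [Complex.mul_im, Complex.ofReal_re, Complex.ofReal_im, Complex.sub_re,
    Complex.sub_im, Complex.one_re, Complex.one_im, Complex.div_ofNat_im, root_re, root_im, sq,
    Complex.mul_re, zero_mul, zero_sub, dRoot]
  field_simp
  ring

end Literature.Barriers.AtomisticToContinuum.BoseGas.LiebLiniger

end
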